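import Summits.CriticalPhenomena.Ising3D.Control2DTaylorCertificateN
import Summits.CriticalPhenomena.Ising3D.Control2DGammaL7Eps1005
import Mathlib.Tactic.Linarith
import HarnessLib

/-!
# The cell obligations of a 2D γ-certificate at `z = z̄ = 1/2` as ONE record (per-cell truncation orders)
(cell `pub-ising3x`, seat controls-1 gen 16; KERNEL PATH for the 2D γ-certificates, Λ = 11 — CONTROL-ONLY)

HONEST FRAMING: lottery ticket; floor = tightest certified 3D Ising CFT bounds; no exact-solution
claim without a proof. CONTROL-ONLY (`d = 2`); nothing numerical is asserted here.

A kernel replay proves, spin by spin, the cell hypotheses of `excludedOn_half_of_explicitN` (kind `box`)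
or `gapExcluded_half_of_explicitN` (kind `gap`, g15) in the witness form `∃ N ≥ E₀, 0 ≤ φ[F_-[Q_N(Δ, ℓ)]]`.
This file packages them as single propositions `BoxCellsN S w s G δ e₁ e₂ E₀` / `GapCellsN S w s U E₀`
(so a certificate's cells are ONE theorem whose statement carries the certificate's own box / gap), with
the assembly theorems `excludedOn_half_of_cellsN`, `boxExcluded_half_of_cellsN`, `gapExcluded_half_of_cellsN`.
[cite: RattazziEtAl2008, §5.5]
-/

namespace Summit.CriticalPhenomena.Ising3D.Control2D

open Finset Set
open Literature.MathematicalPhysics.QuantumFieldTheory.ConformalBootstrap3D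

/-- **The cells of a kind-`box` certificate** for the table functional `φ = taylorFunctional2D (1/2) S w`
at `Δ_σ = s` under `A2D′` (scalar gap `G`, spin-2 gap `δ`, box `[e₁, e₂]`, threshold `E₀`), each with its
own truncation witness: (E) `ℓ = 0` on `[e₁, e₂]`, (C′) `ℓ = 0` on `[G, E₀)`, (T) the point `(2, 2)`,
`ℓ = 2` on `[2+δ, E₀)`, even `ℓ ≥ 4` on `[ℓ, E₀)`. [cite: RattazziEtAl2008, §5.5] -/
def BoxCellsN (S : Finset (ℕ × ℕ)) (w : ℕ × ℕ → ℝ) (s G δ e₁ e₂ E₀ : ℝ) : Prop :=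
  (∀ Δ : ℝ, e₁ ≤ Δ → Δ ≤ e₂ → ∃ N : ℕ, E₀ ≤ N ∧
      0 ≤ taylorFunctional2D (1 / 2) S w (crossF s (-1) (QN N 0 Δ))) ∧
  (∀ Δ : ℝ, G ≤ Δ → Δ < E₀ → ∃ N : ℕ, E₀ ≤ N ∧
      0 ≤ taylorFunctional2D (1 / 2) S w (crossF s (-1) (QN N 0 Δ))) ∧
  (∃ N : ℕ, E₀ ≤ N ∧ 0 ≤ taylorFunctional2D (1 / 2) S w (crossF s (-1) (QN N 2 2))) ∧
  (∀ Δ : ℝ, 2 + δ ≤ Δ → Δ < E₀ → ∃ N : ℕ, E₀ ≤ N ∧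
      0 ≤ taylorFunctional2D (1 / 2) S w (crossF s (-1) (QN N 2 Δ))) ∧
  (∀ ℓ : ℕ, Even ℓ → ℓ ≠ 0 → ℓ ≠ 2 → ∀ Δ : ℝ, (ℓ : ℝ) ≤ Δ → Δ < E₀ → ∃ N : ℕ, E₀ ≤ N ∧
      0 ≤ taylorFunctional2D (1 / 2) S w (crossF s (-1) (QN N ℓ Δ)))

/-- **Kind `box`: (I) + (R) + the cells record ⇒ location-wise exclusion of the box** (`G > 2s`, `s < 1`,
`e₁ ≥ 0`). PROVED (`excludedOn_half_of_explicitN`). [cite: RattazziEtAl2008, §5.5] -/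
theorem excludedOn_half_of_cellsN (S : Finset (ℕ × ℕ)) (w : ℕ × ℕ → ℝ) {s G δ e₁ e₂ E₀ : ℝ}
    (hs1 : s < 1) (hG : 2 * s < G) (he₁ : 0 ≤ e₁) (hG0 : 0 ≤ G) (hδ : 0 ≤ δ)
    (hI : 0 < taylorFunctional2D (1 / 2) S w (crossF s (-1) (fun _ _ => (1 : ℝ))))
    (hR : ∀ (b : ℝ) (J : ℕ), 0 ≤ b → E₀ ≤ 2 * b + J →
      0 ≤ ∑ p ∈ S, w p * ((1 - (-1 : ℝ) ^ (p.1 + p.2)) * 2 ^ (p.1 + p.2) *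
        (qFactor₁ s (b + J) p.1 * qFactor₁ s b p.2 + qFactor₁ s b p.1 * qFactor₁ s (b + J) p.2)))
    (hc : BoxCellsN S w s G δ e₁ e₂ E₀) : ExcludedOn s G δ (Icc e₁ e₂) :=
  excludedOn_half_of_explicitN S w hs1 hG he₁ hG0 hδ hI hR hc.1 hc.2.1 hc.2.2.1 hc.2.2.2.1 hc.2.2.2.2

/-- **Kind `box`: (I) + (R) + the cells record ⇒ `BoxExcluded`** for a box above `2s`. PROVED.
[cite: RattazziEtAl2008, §5.5] -/
theorem boxExcluded_half_of_cellsN (S : Finset (ℕ × ℕ)) (w : ℕ × ℕ → ℝ) {s G δ e₁ e₂ E₀ : ℝ}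
    (hs1 : s < 1) (he : 2 * s < e₁) (hG : 2 * s < G) (he₁ : 0 ≤ e₁) (hG0 : 0 ≤ G) (hδ : 0 ≤ δ)
    (hI : 0 < taylorFunctional2D (1 / 2) S w (crossF s (-1) (fun _ _ => (1 : ℝ))))
    (hR : ∀ (b : ℝ) (J : ℕ), 0 ≤ b → E₀ ≤ 2 * b + J →
      0 ≤ ∑ p ∈ S, w p * ((1 - (-1 : ℝ) ^ (p.1 + p.2)) * 2 ^ (p.1 + p.2) *
        (qFactor₁ s (b + J) p.1 * qFactor₁ s b p.2 + qFactor₁ s b p.1 * qFactor₁ s (b + J) p.2)))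
    (hc : BoxCellsN S w s G δ e₁ e₂ E₀) : BoxExcluded s G δ e₁ e₂ :=
  boxExcluded_half_of_explicitN S w hs1 he hG he₁ hG0 hδ hI hR hc.1 hc.2.1 hc.2.2.1 hc.2.2.2.1 hc.2.2.2.2

/-- **The cells of a kind-`gap` certificate** (`Δ_ε < U` at `Δ_σ = s`), witness form: `ℓ = 0` on `[U, E₀)`
and even `ℓ ≠ 0` on `[ℓ, E₀)`. [cite: RattazziEtAl2008, §5.5] -/
def GapCellsN (S : Finset (ℕ × ℕ)) (w : ℕ × ℕ → ℝ) (s U E₀ : ℝ) : Prop :=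
  (∀ Δ : ℝ, U ≤ Δ → Δ < E₀ → ∃ N : ℕ, E₀ ≤ N ∧
      0 ≤ taylorFunctional2D (1 / 2) S w (crossF s (-1) (QN N 0 Δ))) ∧
  (∀ ℓ : ℕ, Even ℓ → ℓ ≠ 0 → ∀ Δ : ℝ, (ℓ : ℝ) ≤ Δ → Δ < E₀ → ∃ N : ℕ, E₀ ≤ N ∧
      0 ≤ taylorFunctional2D (1 / 2) S w (crossF s (-1) (QN N ℓ Δ)))

/-- **Kind `gap`: (I) + (R) + the cells record ⇒ `GapExcluded s U`** (`2s < U`, `0 ≤ s < 1`). PROVED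
(`gapExcluded_half_of_explicitN`, g15). [cite: RattazziEtAl2008, §5.5] -/
theorem gapExcluded_half_of_cellsN (S : Finset (ℕ × ℕ)) (w : ℕ × ℕ → ℝ) {s U E₀ : ℝ}
    (hs0 : 0 ≤ s) (hs1 : s < 1) (hU2 : 2 * s < U)
    (hI : 0 < taylorFunctional2D (1 / 2) S w (crossF s (-1) (fun _ _ => (1 : ℝ))))
    (hR : ∀ (b : ℝ) (J : ℕ), 0 ≤ b → E₀ ≤ 2 * b + J →
      0 ≤ ∑ p ∈ S, w p * ((1 - (-1 : ℝ) ^ (p.1 + p.2)) * 2 ^ (p.1 + p.2) *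
        (qFactor₁ s (b + J) p.1 * qFactor₁ s b p.2 + qFactor₁ s b p.1 * qFactor₁ s (b + J) p.2)))
    (hc : GapCellsN S w s U E₀) : GapExcluded s U :=
  gapExcluded_half_of_explicitN S w hs0 hs1 hU2 hI hR hc.1 hc.2

end Summit.CriticalPhenomena.Ising3D.Control2D
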